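import Summits.QuantumFields.BalabanUV.Beta.FP.KernelStepDressingRecentre
import Summits.QuantumFields.BalabanUV.Beta.FP.WoundEvenFamilyTorus

/-!
# `BalabanUV.Beta.FP.WoundFamilyPeriodised` — road «FP», binder row D1, ROUTE T (β1), (H5-F box) junctions, THE ROAD's ANALYTIC PIECE (i), THE WINDING LAYER:
# **THE DIAGONAL AND THE TORUS PERIODISATION PASS THROUGH THE SOURCE WINDING OF A SWAP-SYMMETRIC SECOND-ORDER FAMILY** —
# `perF M (dper M (x z ↦ Σ'_e W μ y ν (y′ + M′∘e) x z)) p q = Σ'_e perF M (dper M (W μ y ν (y′ + M′∘e))) p q` (`M = N·M′`), and the same for its even half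

WHY (located).  The END's second-order F-letters read `perF T (dper T (𝒲bF (n+1) B μ y ν y′))` where `𝒲bF` is the SOURCE-WOUND EVEN HALF
`x z a b ↦ Σ'_e (𝒲F (n+1) μ y ν (translate (Mc B) y′ e))♮ x z a b` of the dressed family `𝒲F (n+1) = σ′•Lc⁸•dressW …` (skeleton v10-O; road g58 FILE 3∕5).  The dressing layers
are `KernelStepDressingPeriodised` (p743874 ✓, first order) and `KernelStepDressingPeriodisedW` (g60, second order); THIS file is the winding layer in between: for a
swap-symmetric `VertexFamily₂` family the members `W μ y ν (y′ + M′∘e)` are ALL bi-localised at the SAME pair `(N•y, N•y)` with constants `Cw·e^{−(δ∕2)|N•y′ + M∘e − N•y|₁}`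
summable in `e` (an2 PART 15c `biLoc_sep_of_swap` — the swap symmetry supplies the source separation for free, as in g59's `hWFw`; PART 18 `biLoc_wound_sum`'s constants) — a
COMMON-PAIR family, so p743874 §0's `dper_tsum_family₂` and the road's `KernelStepDressingRecentre.perZ_dper_tsum_family₂` interchange the winding sum with BOTH periodisations
member by member (no 2-D summability needed after all: the second centre's motion is absorbed by the separation factor).  With `dressW_swap` (g59 `TowerFWindingRow`) and
`vertexFamily₂_dressW` (g58 (A)) the dressed F-family qualifies; the END-level instantiation belongs to the junction memo with the row ((C1) class).

WHAT ([folklore] lattice-sum bookkeeping; generic dimension `d`; no `def`, no `def … : Prop`, nothing cited, 0 sorry).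
§1 `abs_wound_member_le` (the common-pair bound of the `e`-th member), `summable_woundWeight` (its constants, leaf-06 `summable_exp_l1_translate`);
**`dper_wound_apply`**, **`perZ_dper_wound_apply`**, **`perF_dper_wound`** (the three interchanges); §2 the EVEN HALF: `perF_dper_woundEvenHalf` (PART 18
`perF_dper_wound_evenHalf_apply` + §1: `= ½(Σ'_e perF M (dper M (W …e)) p q + sgnF·sgnF·Σ'_e perF M (dper M (W …e)) q p)`).
WHAT THIS IS NOT: not the dressed instance, not a junction (the row's (C1) words (ii)(iii)); nothing of Bałaban's asserted, valued or discharged; 0 estimates beyond [folklore]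
geometric series BY NAME; 0∕4 row-D1 binders; NOT (C1), NOT (T-ID), NOT D1, NEVER «G-an2-4 closed», NOT BetaPertH, NOT continuum, NOT Clay.
HONEST DEPENDENCY (page 1, mandatory): continuum YM on T⁴ ⇐ BetaPertH ∧ nine spine estimates (0/9 proved); BetaPertH ⇐ (D1) ∧ (D4) ∧ CAP+tail;
G-an2-4 gates asym, D1 and NE2/3/4.  HONEST FRAMING (cell contract, verbatim): «discharging `BetaPertH` makes Bałaban's UV stability UNCONDITIONAL —
a real constructive-QFT result; it is NOT the continuum limit and NOT the Clay problem.»  ABSOLUTE RULE (cell charter, verbatim): «No internally-minted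
statement may enter as a cited fact. Every hypothesis is either kernel-proved in this package or a verbatim quotation of a PUBLISHED theorem with page
reference. The manuscript(s) under audit are NOT citable for their own disputed steps — they are the thing under adjudication; programme-internal
(2001/route/tribunal) claims are never citable.»  Road «FP» OWNER, b2b-balaban-beta-d1-p3 gen 60, 2026-08-29.  No existing file touched.
-/

noncomputable section

open scoped BigOperators

namespace Summit.QuantumFields.BalabanUV.Beta.FP.WoundFamilyPeriodised

open Literature.MathematicalPhysics.QuantumFieldTheory
open Literature.MathematicalPhysics.QuantumFieldTheory.Balaban1983to89
open Literature.MathematicalPhysics.QuantumFieldTheory.Balaban1983to89.Beta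
open B12Sec2to5 (l1 l1_nonneg)
open B4TorusKernel.MultiPeriod (translate translate_apply)
open ExpKernelCalculus (Site MKer BiLoc VertexFamily₂)
open OneStepResolventKernel (Fib)
open Summit.QuantumFields.BalabanUV.Beta.BorderedHessian (sgnF sgnK)
open Summit.QuantumFields.BalabanUV.Beta.TameKernelCalculus (trK)
open Summit.QuantumFields.BalabanUV.Beta.CombHId1Letters (nsmul_translate)
open Summit.QuantumFields.BalabanUV.Beta.FP.KernelPeriodisationFib (Idx perF perF_apply perZ perZ_apply)
open Summit.QuantumFields.BalabanUV.Beta.FP.KernelPeriodisationFibLoc (dper dper_apply summable_exp_l1_translate)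
open Summit.QuantumFields.BalabanUV.Beta.FP.KernelPeriodisationFibWoundLetter (biLoc_sep_of_swap)
open Summit.QuantumFields.BalabanUV.Beta.FP.KernelStepDressingPeriodised (dper_tsum_family₂)
open Summit.QuantumFields.BalabanUV.Beta.FP.KernelStepDressingRecentre (perZ_dper_tsum_family₂)
open Summit.QuantumFields.BalabanUV.Beta.FP.WoundEvenFamilyTorus (perF_dper_wound_evenHalf_apply)

variable {d : ℕ} {N : ℕ} {M M' : Fin (d + 1) → ℕ} [∀ i, NeZero (M i)]
  {W : Fin (d + 1) → Site (d + 1) → Fin (d + 1) → Site (d + 1) → MKer (d + 1) (Fib d)} {Cw δ : ℝ}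

/-! ## §1 The winding sum through both periodisations, member by member -/

omit [∀ i, NeZero (M i)] in
/-- [folklore] **the `e`-th wound member is bi-localised at the COMMON pair `(N•y, N•y)`** with constant `Cw·e^{−(δ∕2)|translate M (N•y′) e − N•y|₁}`, rate `δ∕4`
(PART 15c `biLoc_sep_of_swap` at the translated source; `N•(y′ + M′∘e) = N•y′ + M∘e` by `nsmul_translate`). -/
theorem abs_wound_member_le (hM : ∀ i, M i = N * M' i) (hs : ∀ μ y ν y', W ν y' μ y = W μ y ν y') (hW : VertexFamily₂ W N Cw δ) (hδ : 0 < δ)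
    (μ : Fin (d + 1)) (y : Site (d + 1)) (ν : Fin (d + 1)) (y' e x z : Site (d + 1)) (a b : Fib d) :
    |W μ y ν (translate M' y' e) x z a b|
      ≤ (Cw * Real.exp (-(δ / 2) * l1 (translate M ((N : ℤ) • y') e - (N : ℤ) • y)))
          * Real.exp (-(δ / 4) * (l1 (x - (N : ℤ) • y) + l1 (z - (N : ℤ) • y))) := by
  have h := biLoc_sep_of_swap hs hW hδ.le μ y ν (translate M' y' e) x z a b
  rwa [nsmul_translate hM] at h

/-- [folklore] the wound members' constants are summable in the winding index (leaf-06 `summable_exp_l1_translate`). -/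
theorem summable_woundWeight (hδ : 0 < δ) (Cw : ℝ) (y y' : Site (d + 1)) :
    Summable fun e : Site (d + 1) => Cw * Real.exp (-(δ / 2) * l1 (translate M ((N : ℤ) • y') e - (N : ℤ) • y)) :=
  (summable_exp_l1_translate M (half_pos hδ) ((N : ℤ) • y) ((N : ℤ) • y')).1.mul_left Cw

/-- [folklore] **`dper_wound_apply` — THE DIAGONAL PERIODISATION PASSES THROUGH THE WINDING**:
`dper M (x z ↦ Σ'_e W μ y ν (translate M′ y′ e) x z) x z a b = Σ'_e dper M (W μ y ν (translate M′ y′ e)) x z a b`. -/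
theorem dper_wound_apply (hM : ∀ i, M i = N * M' i) (hs : ∀ μ y ν y', W ν y' μ y = W μ y ν y') (hW : VertexFamily₂ W N Cw δ) (hδ : 0 < δ)
    (μ : Fin (d + 1)) (y : Site (d + 1)) (ν : Fin (d + 1)) (y' x z : Site (d + 1)) (a b : Fib d) :
    dper M (fun x z a b => ∑' e : Site (d + 1), W μ y ν (translate M' y' e) x z a b) x z a b
      = ∑' e : Site (d + 1), dper M (W μ y ν (translate M' y' e)) x z a b := by
  have hCw : 0 ≤ Cw := (hW μ y ν y').nonneg (Sum.inl 0)
  exact dper_tsum_family₂ M (T := fun e : Site (d + 1) => W μ y ν (translate M' y' e))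
    (fun e x z a b => abs_wound_member_le hM hs hW hδ μ y ν y' e x z a b) (summable_woundWeight hδ Cw y y')
    (fun e => by positivity) (by positivity) x z a b

/-- [folklore] **`perZ_dper_wound_apply` — THE TORUS PERIODISATION PASSES THROUGH THE WINDING TOO**:
`perZ M (dper M (x z ↦ Σ'_e W μ y ν (translate M′ y′ e) x z)) x z a b = Σ'_e perZ M (dper M (W μ y ν (translate M′ y′ e))) x z a b`. -/
theorem perZ_dper_wound_apply (hM : ∀ i, M i = N * M' i) (hs : ∀ μ y ν y', W ν y' μ y = W μ y ν y') (hW : VertexFamily₂ W N Cw δ) (hδ : 0 < δ)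
    (μ : Fin (d + 1)) (y : Site (d + 1)) (ν : Fin (d + 1)) (y' x z : Site (d + 1)) (a b : Fib d) :
    perZ M (dper M (fun x z a b => ∑' e : Site (d + 1), W μ y ν (translate M' y' e) x z a b)) x z a b
      = ∑' e : Site (d + 1), perZ M (dper M (W μ y ν (translate M' y' e))) x z a b := by
  have hCw : 0 ≤ Cw := (hW μ y ν y').nonneg (Sum.inl 0)
  exact perZ_dper_tsum_family₂ M (T := fun e : Site (d + 1) => W μ y ν (translate M' y' e))
    (fun e x z a b => abs_wound_member_le hM hs hW hδ μ y ν y' e x z a b) (summable_woundWeight hδ Cw y y')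
    (fun e => by positivity) (by positivity) x z a b

/-- [folklore] **`perF_dper_wound` — ON THE TORUS**: `perF M (dper M (x z ↦ Σ'_e W μ y ν (translate M′ y′ e) x z)) p q = Σ'_e perF M (dper M (W μ y ν (translate M′ y′ e))) p q`. -/
theorem perF_dper_wound (hM : ∀ i, M i = N * M' i) (hs : ∀ μ y ν y', W ν y' μ y = W μ y ν y') (hW : VertexFamily₂ W N Cw δ) (hδ : 0 < δ)
    (μ : Fin (d + 1)) (y : Site (d + 1)) (ν : Fin (d + 1)) (y' : Site (d + 1)) (p q : Idx M (Fib d)) :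
    perF M (dper M (fun x z a b => ∑' e : Site (d + 1), W μ y ν (translate M' y' e) x z a b)) p q
      = ∑' e : Site (d + 1), perF M (dper M (W μ y ν (translate M' y' e))) p q := by
  simp only [perF_apply]
  exact perZ_dper_wound_apply hM hs hW hδ μ y ν y' _ _ _ _

/-! ## §2 The even half -/

/-- [folklore] **`perF_dper_woundEvenHalf` — THE END's SOURCE-WOUND EVEN HALF ON THE TORUS, MEMBER BY MEMBER**:
`perF M (dper M (x z ↦ Σ'_e (W μ y ν (y′+M′∘e))♮ x z)) p q = ½·(Σ'_e perF M (dper M (W …e)) p q + sgnF p.2 · sgnF q.2 · Σ'_e perF M (dper M (W …e)) q p)`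
(PART 18 `perF_dper_wound_evenHalf_apply` reduces `♮` to the plain winding and its transpose; §1 twice). -/
theorem perF_dper_woundEvenHalf (hM : ∀ i, M i = N * M' i) (hs : ∀ μ y ν y', W ν y' μ y = W μ y ν y') (hW : VertexFamily₂ W N Cw δ) (hδ : 0 < δ)
    (μ : Fin (d + 1)) (y : Site (d + 1)) (ν : Fin (d + 1)) (y' : Site (d + 1)) (p q : Idx M (Fib d)) :
    perF M (dper M (fun x w a b => ∑' e : Site (d + 1),
        ((1 / 2 : ℝ) • (W μ y ν (translate M' y' e) + sgnK (trK (W μ y ν (translate M' y' e))))) x w a b)) p q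
      = (1 / 2 : ℝ) * ((∑' e : Site (d + 1), perF M (dper M (W μ y ν (translate M' y' e))) p q)
          + sgnF p.2 * sgnF q.2 * ∑' e : Site (d + 1), perF M (dper M (W μ y ν (translate M' y' e))) q p) := by
  rw [perF_dper_wound_evenHalf_apply M hM hs hW hδ μ y ν y' p q, perF_dper_wound hM hs hW hδ μ y ν y' p q, perF_dper_wound hM hs hW hδ μ y ν y' q p]

end Summit.QuantumFields.BalabanUV.Beta.FP.WoundFamilyPeriodised

end
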